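/-
Origin: expansion seat `prover-pub-hodgecm-mc-binder-2-g16-0`, handover #83 2026-08-20T16:30Z md5 cd52574bfc21 (NEW; 251 l.; 16 theorems, 0 def, 0 structure, 0 `def … : Prop`, nothing cited as hypothesis; KERNEL ONLY; MODEL-N ±0; E untouched. (J4b)/(J4a) CENSUS-SIDE DATUM D1–D3 of `g15/JLIU-J4B-DATUM.md` a3af3a85702a: `SignRecipe.eta_eq_imagUnit` (rfl: recipe `η_L` ≡ Weil datum `δ_L`), Liu-admissibility sets `{τ ∣ Im τ(δ_L a_i) ≷ 0}` = `liftType`/`bar liftType` bit-split (`posImSet_imagUnit_mul_eq_liftType_false` …) and bit-free on a full `Aut(L)`-orbit (`…_of_orbit`, via (R1) `liftType_true_eq_bar_liftType_false`), the ι₁-anchor from the recipe (`GoodCtx.im_ι₁_eta_mul_a_pos`) and from the census under the OG guard (`SInstance.im_ι₁_imagUnit_mul_a_pos_of_GOG`, via `hpos_GOG` + carch `cmXW_pos_iff_of_embedding_eq`), packaged `SInstance.exists_posImSet_imagUnit_mul_of_GOG{,_of_orbit}`. CERT (lean-direct, g16 farm over PKG RUN-54 oleans + binder-1's staged (S1)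 50ecc0b0e7ee ∕ (R1) bdcf341bf713 compiled first): rc 0 ∕ 6 s ∕ 0 warn ∕ 0 proof-hole (`g16/farm/logs/summary.tsv` 16:23:38Z); `#print axioms` 11 ∕ 11 ⊆ {propext, Classical.choice, Quot.sound} (`g16/certs/axioms-jliu-on-r54.log` cebe14c4b253). NAME LIST (namespace `HodgeCM.SignRecipe`): eta_eq_imagUnit · isRep_iff_imagUnit · im_embedding_imagUnit_mul · orientBitι_eq_false_iff_im_eta_pos · orientBitι_eq_true_iff_im_eta_neg · posImSet_imagUnit_mul_eq_liftType_false · negImSet_imagUnit_mul_eq_bar_liftType_false · posImSet_imagUnit_mul_eq_bar_liftType_true · negImSet_imagUnit_mul_eq_liftType_true · posImSet_imagUnit_mul_eq_liftType_false_of_orbit · negImSet_imagUnit_mul_eq_bar_liftType_false_of_orbit · GoodCtx.im_ι₁_eta_mul_a_pos; (namespace `HodgeCM.Model.SInstance`): im_ι₁_imagUnit_mul_a_pos_of_GOG · im_ι₁_eta_mul_a_pos_of_GOG · exists_posImSet_imagUnit_mul_of_GOG · exists_posImSet_imagUnit_mul_of_GOG_of_orbit) (`HOME/mc/pub-hodgecm-mc-binder-2/g16/stage56/HodgeCM/Model/HypCensus/JLiuDeltaSign.lean`,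 md5 cd52574bfc21, 251 lines);
landed by the second packager p2 gen 10 (p2-g10) in gate run 56 as `HodgeCM/Model/HypCensus/JLiuDeltaSign.lean` (verbatim).
-/
/-
Origin: speedrun cell pub-hodgecm, MODEL-CONSTRUCTION sub-cell, unit pub-hodgecm-mc-binder-2-g15 (BINDER PROVER, gen 15; the census-side
half of binder-1-g14's (J4b) ∕ (J4a) read-off asks, STATUS 2026-08-20 15:44:48Z ∕ 15:49:23Z, `JLIU-THETA-SCOPE.md` §6), seat
prover-pub-hodgecm-mc-binder-2-g15-0, 2026-08-20.  Target in PKG: HodgeCM/Model/HypCensus/JLiuDeltaSign.lean (NEW additive leaf; imports binder-1's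
(S1) `Binders/JLiuSignType` + (R1) `Binders/JLiuReflexLift` (staged `mc/pub-hodgecm-mc-binder-1-g14/stage55/`, 1cabd06dbaec ∕ bdcf341bf713) and the
installed sinst-1 `Model/ThetaAdelicSideReadOff` (#1212)).  KERNEL ONLY: theorems; 0 defs, 0 records, nothing cited as a hypothesis,
0 `def … : Prop`; MODEL-N ±0; E unchanged.  Nothing here is a claim of the manuscripts under adjudication.
-/
import Summits.HodgeConjecture.HodgeCM.Model.Binders.JLiuSignType
import Summits.HodgeConjecture.HodgeCM.Model.Binders.JLiuReflexLift
import Summits.HodgeConjecture.HodgeCM.Model.ThetaAdelicSideReadOff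

/-!
# (J4b)/(J4a) census-side read-off: the sign recipe's `η_L` IS the Weil datum's `δ_L`, and Liu's admissibility
# inequality `Im τ′(e) < 0` read on the CONSTRUCTED symplectic datum

binder-1-g14's scope (`JLIU-THETA-SCOPE.md` §2 (J4b), §6) asks, of the model's Weil representation of `U(V) × U(W_i)`
(`UnitaryDualPair.cmSplittingDatum … (dW c.D) …`, `HypCensus.cmXW`), with which SIGN the hermitian line `a_i = c.D.a i` is read as
[Liu21, Def. 4.12]'s trace-zero scalar `e`, and states (S1)'s admissibility sets with the recipe's unit `η_L = SignRecipe.eta L`.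

§ 1 **`SignRecipe.eta L = UnitaryDualPair.imagUnit L` — DEFINITIONALLY** (`rfl`: both are `x - x̄` for `x := Classical.choose` of the
    SAME proposition `∃ x, complexConj L x ≠ x`, `conjRingHomK L x` unfolding to `IsCMField.complexConj L x`).  So the purely imaginary unit
    `δ_L` through which the tree builds the symplectic form of `Res_{L/L⁺}(V ⊗ W)` (`IsQuadraticCoordinates … (imagUnit L) …`: the form is the
    `δ`-COORDINATE of `x̄ᵀ (T_V ⊗ T_W) y`, `UnitaryGroup.IsQuadraticCoordinates.im_hermForm_map`), the unit of the slot tables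
    (`ArchSideTerm.slotDelta`), of the orientation bit (`orientBitι L ι₁ := decide (im ι₁(δ_L) < 0)`, #CA16) and the unit of PerL's sign recipe
    (`SignRecipe.reqPos ∕ SignsForced ∕ IsRep`, E's `GoodCtx.forced`) are ONE element: no place-dependent sign bookkeeping between «recipe» and
    «Weil datum» can arise — only the ONE global bit `h`.
§ 2 (S1)'s admissibility sets WITHOUT the orientation factor `im ι₁(η_L)`, i.e. in [Liu21, Def. 4.12]'s own shape `{τ′ ∣ Im τ′(e) ≶ 0}` for
    `e = δ_L · a_i`, split by the bit: `orientBitι = false` (`0 < im ι₁ δ_L`): `{0 < Im τ(δ_L a_i)} = Φ_{Ψ_i}^{(false)}`, `{Im τ(δ_L a_i) < 0} = bar Φ_{Ψ_i}^{(false)}`;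
    `orientBitι = true`: `{0 < Im τ(δ_L a_i)} = bar Φ_{Ψ_i}^{(true)}`, `{Im τ(δ_L a_i) < 0} = Φ_{Ψ_i}^{(true)}`; and on a full `Aut(L)`-orbit of `ι₁`
    ((R1) `liftType_true_eq_bar_liftType_false`) BOTH bits give `{0 < Im τ(δ_L a_i)} = Φ_{Ψ_i}^{(false)}` = Shimura's `S*`-type (∋ ι₁).
§ 3 THE ANCHOR AT `ι₁`, from the census side: under the OG guard `SInstance.GOG V c` the four slot-positivity facts `SInstance.hpos_GOG` read,
    through carch's `cmXW_pos_iff_of_embedding_eq`, **`0 < Im ι₁(δ_L · a_i)` for every `i : Fin 4`** (`im_ι₁_imagUnit_mul_a_pos_of_GOG`) — the SAME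
    inequality the recipe gives (`im_ι₁_eta_mul_a_pos_of_goodCtx`, from (S1) alone).  Read against [Liu21, Thm. 4.15 ∕ Lemma 10.2 (2)] («`τ′ = ι₁ ∈ Φ_μ`»
    for a `(1,0)`-contribution at the place of `ι₁`) and Def. 4.12 («`Im τ′(e) < 0` on `Φ_μ`»): the label of the model's line `W_i` in Liu's
    bookkeeping is `e_i ∈ (L⁺)_{≫0} · (−δ_L a_i)` and `Φ_{μ_Liu} = {τ ∣ 0 < Im τ(δ_L a_i)} = Φ_{Ψ_i}^{(false)}` (§ 2), whose reflex pair is the corner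
    `(c.K, c.Ψ i)` by (R1) — the `CommonReflexInput` type of row 9.  (The absolute sign of `e` against Liu's App. C display is a PRINT matter for
    r1/r2 — `ψ_model = adeleAddChar` is Tate's `e^{−2πi x}` at ∞, Liu's `ψ_F` is `e^{+2πi x}` (§1.5) —; it is ONE GLOBAL bit (`h ↦ ¬h`,
    `Φ ↦ bar Φ`), never place-dependent, by § 1.)
-/

set_option autoImplicit false

noncomputable section

open NumberField
open Literature.NumberTheory.GelbartRogawski1991.UnitaryDualPair (imagUnit)

namespace HodgeCM

namespace SignRecipe

open HodgeCM.CMTypeOps (bar mem_bar_iff)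

/-! ## 1. `η_L` IS `δ_L` -/

/-- **The sign recipe's `η_L` and the Weil datum's `δ_L` are the same element of `L`** (definitionally: `Classical.choose` of one
proposition).  Every statement of the recipe about `η_L` is a statement about the `δ` of `UnitaryDualPair.cmSplittingDatum`. [folklore] -/
theorem eta_eq_imagUnit (L : CMField) : eta L = imagUnit (L : Type) := rfl

/-- `IsRep` read on `δ_L`: `τ` is the representative of its place iff `im τ(δ_L) · im ι₁(δ_L) > 0`. [folklore] -/
theorem isRep_iff_imagUnit {L : CMField} (ι₁ τ : L →+* ℂ) :
    IsRep L ι₁ τ ↔ 0 < (τ (imagUnit (L : Type))).im * (ι₁ (imagUnit (L : Type))).im := Iff.rfl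

/-- `Im τ(δ_L · x) = Im τ(δ_L) · Re τ(x)`. [folklore] -/
theorem im_embedding_imagUnit_mul {L : CMField} (τ : L →+* ℂ) (x : L) :
    (τ (imagUnit (L : Type) * x)).im = (τ (imagUnit (L : Type))).im * (τ x).re :=
  im_embedding_eta_mul τ x

/-- the orientation bit of #CA16 read on `η_L`: `orientBitι L ι₁ = false ↔ 0 < im ι₁(η_L)`. [folklore] -/
theorem orientBitι_eq_false_iff_im_eta_pos {L : CMField} (ι₁ : L →+* ℂ) :
    Model.orientBitι L ι₁ = false ↔ 0 < (ι₁ (eta L)).im :=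
  Model.orientBitι_eq_false_iff

/-- … and `orientBitι L ι₁ = true ↔ im ι₁(η_L) < 0`. [folklore] -/
theorem orientBitι_eq_true_iff_im_eta_neg {L : CMField} (ι₁ : L →+* ℂ) :
    Model.orientBitι L ι₁ = true ↔ (ι₁ (eta L)).im < 0 :=
  Model.orientBitι_eq_true_iff

/-! ## 2. Liu's admissibility sets `{τ ∣ Im τ(δ_L a_i) ≶ 0}` on the recipe, split by the orientation bit -/

section Liu

variable {K L : CMField} {j : K →+* L} {ι₁ : L →+* ℂ} {Ψ : Fin 4 → Literature.AlgebraicGeometry.Motives.CMType K}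
  {D : StubTree.SeesawDatum L}

/-- **bit `false` (`0 < im ι₁ δ_L`): `{τ ∣ 0 < Im τ(δ_L a_i)} = Φ_{Ψ_i}^{(false)}`.** [folklore] -/
theorem posImSet_imagUnit_mul_eq_liftType_false (hb : Model.orientBitι L ι₁ = false) (hs : SignsForced false K L j ι₁ Ψ D) (i : Fin 4) :
    {τ : L →+* ℂ | 0 < (τ (imagUnit (L : Type) * D.a i)).im} = (liftType false K L j ι₁ (Ψ i)).1 := by
  have hι : 0 < (ι₁ (eta L)).im := (orientBitι_eq_false_iff_im_eta_pos ι₁).mp hb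
  rw [← posImSet_eta_mul_eq_liftType hs i]
  ext τ
  simp only [Set.mem_setOf_eq]
  change 0 < (τ (eta L * D.a i)).im ↔ 0 < (τ (eta L * D.a i)).im * (ι₁ (eta L)).im
  constructor
  · intro hτ; exact mul_pos hτ hι
  · intro hτ
    rcases mul_pos_iff.mp hτ with ⟨h1, _⟩ | ⟨_, h2⟩
    · exact h1
    · exact absurd h2 (not_lt.mpr hι.le)

/-- bit `false`: `{τ ∣ Im τ(δ_L a_i) < 0} = bar Φ_{Ψ_i}^{(false)}`. [folklore] -/
theorem negImSet_imagUnit_mul_eq_bar_liftType_false (hb : Model.orientBitι L ι₁ = false) (hs : SignsForced false K L j ι₁ Ψ D) (i : Fin 4) :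
    {τ : L →+* ℂ | (τ (imagUnit (L : Type) * D.a i)).im < 0} = (bar (liftType false K L j ι₁ (Ψ i))).1 := by
  have hι : 0 < (ι₁ (eta L)).im := (orientBitι_eq_false_iff_im_eta_pos ι₁).mp hb
  rw [← negImSet_eta_mul_eq_bar_liftType hs i]
  ext τ
  simp only [Set.mem_setOf_eq]
  change (τ (eta L * D.a i)).im < 0 ↔ (τ (eta L * D.a i)).im * (ι₁ (eta L)).im < 0
  constructor
  · intro hτ; exact mul_neg_of_neg_of_pos hτ hι
  · intro hτ
    rcases mul_neg_iff.mp hτ with ⟨_, h2⟩ | ⟨h1, _⟩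
    · exact absurd h2 (not_lt.mpr hι.le)
    · exact h1

/-- **bit `true` (`im ι₁ δ_L < 0`): `{τ ∣ 0 < Im τ(δ_L a_i)} = bar Φ_{Ψ_i}^{(true)}`.** [folklore] -/
theorem posImSet_imagUnit_mul_eq_bar_liftType_true (hb : Model.orientBitι L ι₁ = true) (hs : SignsForced true K L j ι₁ Ψ D) (i : Fin 4) :
    {τ : L →+* ℂ | 0 < (τ (imagUnit (L : Type) * D.a i)).im} = (bar (liftType true K L j ι₁ (Ψ i))).1 := by
  have hι : (ι₁ (eta L)).im < 0 := (orientBitι_eq_true_iff_im_eta_neg ι₁).mp hb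
  rw [← negImSet_eta_mul_eq_bar_liftType hs i]
  ext τ
  simp only [Set.mem_setOf_eq]
  change 0 < (τ (eta L * D.a i)).im ↔ (τ (eta L * D.a i)).im * (ι₁ (eta L)).im < 0
  constructor
  · intro hτ; exact mul_neg_of_pos_of_neg hτ hι
  · intro hτ
    rcases mul_neg_iff.mp hτ with ⟨h1, _⟩ | ⟨_, h2⟩
    · exact h1
    · exact absurd h2 (not_lt.mpr hι.le)

/-- bit `true`: `{τ ∣ Im τ(δ_L a_i) < 0} = Φ_{Ψ_i}^{(true)}`. [folklore] -/
theorem negImSet_imagUnit_mul_eq_liftType_true (hb : Model.orientBitι L ι₁ = true) (hs : SignsForced true K L j ι₁ Ψ D) (i : Fin 4) :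
    {τ : L →+* ℂ | (τ (imagUnit (L : Type) * D.a i)).im < 0} = (liftType true K L j ι₁ (Ψ i)).1 := by
  have hι : (ι₁ (eta L)).im < 0 := (orientBitι_eq_true_iff_im_eta_neg ι₁).mp hb
  rw [← posImSet_eta_mul_eq_liftType hs i]
  ext τ
  simp only [Set.mem_setOf_eq]
  change (τ (eta L * D.a i)).im < 0 ↔ 0 < (τ (eta L * D.a i)).im * (ι₁ (eta L)).im
  constructor
  · intro hτ; exact mul_pos_of_neg_of_neg hτ hι
  · intro hτ
    rcases mul_pos_iff.mp hτ with ⟨_, h2⟩ | ⟨h1, _⟩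
    · exact absurd h2 (not_lt.mpr hι.le)
    · exact h1

/-- **BIT-FREE, on a full `Aut(L)`-orbit of `ι₁` (`L/ℚ` normal):** whatever the orientation bit `h = orientBitι L ι₁`, the set where
`δ_L a_i` has POSITIVE imaginary part is Shimura's type `Φ_{Ψ_i}^{(false)} = S*` and the set where it is NEGATIVE is its conjugate. [folklore] -/
theorem posImSet_imagUnit_mul_eq_liftType_false_of_orbit {h : Bool} (hb : Model.orientBitι L ι₁ = h) (hs : SignsForced h K L j ι₁ Ψ D)
    (horbit : ∀ τ : L →+* ℂ, ∃ g : L ≃+* L, ι₁.comp g.toRingHom = τ) (i : Fin 4) :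
    {τ : L →+* ℂ | 0 < (τ (imagUnit (L : Type) * D.a i)).im} = (liftType false K L j ι₁ (Ψ i)).1 := by
  cases h
  · exact posImSet_imagUnit_mul_eq_liftType_false hb hs i
  · rw [posImSet_imagUnit_mul_eq_bar_liftType_true hb hs i]
    ext τ
    rw [mem_bar_iff, liftType_true_eq_bar_liftType_false (Ψ i) horbit, mem_bar_iff, not_not]

/-- (Ported verbatim from the HodgeCMPerL package; no docstring in the source.) -/
theorem negImSet_imagUnit_mul_eq_bar_liftType_false_of_orbit {h : Bool} (hb : Model.orientBitι L ι₁ = h) (hs : SignsForced h K L j ι₁ Ψ D)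
    (horbit : ∀ τ : L →+* ℂ, ∃ g : L ≃+* L, ι₁.comp g.toRingHom = τ) (i : Fin 4) :
    {τ : L →+* ℂ | (τ (imagUnit (L : Type) * D.a i)).im < 0} = (bar (liftType false K L j ι₁ (Ψ i))).1 := by
  cases h
  · exact negImSet_imagUnit_mul_eq_bar_liftType_false hb hs i
  · rw [negImSet_imagUnit_mul_eq_liftType_true hb hs i]
    exact liftType_true_eq_bar_liftType_false (Ψ i) horbit

end Liu

/-! ## 3. The anchor at `ι₁` -/

namespace GoodCtx

variable {L : CMField} {ι₁ : L →+* ℂ} {c : SeesawCtx L}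

/-- **From the recipe alone: under `GoodCtx (orientBitι L ι₁) ι₁ c`, `0 < Im ι₁(δ_L · a_i)` for every `i`** (the forced sign of `a_i` at the
distinguished embedding is the indicator of `ι₁ ∈ Φ_{Ψ_i}^{(h)}`, and `ι₁ ∈ Φ^{(false)}` ∕ `ι₁ ∈ bar Φ^{(true)}` by (S1)). [folklore] -/
theorem im_ι₁_eta_mul_a_pos (hc : GoodCtx (Model.orientBitι L ι₁) ι₁ c) (i : Fin 4) : 0 < (ι₁ (eta L * c.D.a i)).im := by
  obtain ⟨j, hj, hs⟩ := hc.forced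
  have key : 0 < (ι₁ (c.D.a i)).re ↔ ι₁ ∈ (liftType (Model.orientBitι L ι₁) c.K L j ι₁ (c.Ψ i)).1 :=
    signsForced_iff_rep hs i (isRep_self L ι₁)
  rw [im_embedding_eta_mul]
  cases hb : Model.orientBitι L ι₁
  · have hι : 0 < (ι₁ (eta L)).im := (orientBitι_eq_false_iff_im_eta_pos ι₁).mp hb
    rw [hb] at key hc
    exact mul_pos hι (key.mpr (self_mem_liftType hc hj i))
  · have hι : (ι₁ (eta L)).im < 0 := (orientBitι_eq_true_iff_im_eta_neg ι₁).mp hb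
    rw [hb] at key hc
    have hmem := self_mem_bar_liftType hc hj i
    rw [mem_bar_iff] at hmem
    have hre : (ι₁ (c.D.a i)).re < 0 :=
      lt_of_le_of_ne (not_lt.mp fun h => hmem (key.mp h)) (re_embedding_ne_zero_of_conj_eq (c.D.a_real i) (c.D.a_ne i) ι₁)
    exact mul_pos_of_neg_of_neg hι hre

end GoodCtx

end SignRecipe

namespace Model.SInstance

open HodgeCM.SignRecipe HodgeCM.CMTypeOps

variable {L : CMField} {ι₁ : L →+* ℂ} (V : HermSpace3 L ι₁) (c : SeesawCtx L)

/-- **THE ANCHOR FROM THE CENSUS SIDE: under the OG guard, `0 < Im ι₁(δ_L · a_i)` for each of the four lines** — sinst-1's four slot-positivity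
facts `hpos_GOG` (`0 < cmXW … (lineVec (a_i)) … ι₁ (cmPlace ι₁) 0`) read through carch's ID-branch dictionary `cmXW_pos_iff_of_embedding_eq`
(`… ↔ 0 < re ι₁(a_i) · im ι₁(δ_L)`).  With [Liu21, Def. 4.12 ∕ Thm. 4.15]: the skew-hermitian scalar of `W_i` is Liu-admissible for a CM type containing
`ι₁` exactly when it is a totally positive multiple of `−δ_L a_i`. [folklore] -/
theorem im_ι₁_imagUnit_mul_a_pos_of_GOG (hc : GOG V c) (i : Fin 4) : 0 < (ι₁ (imagUnit (L : Type) * c.D.a i)).im := by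
  have hpos := hpos_GOG V c hc
  rw [im_embedding_imagUnit_mul, mul_comm]
  fin_cases i
  · exact (cmXW_pos_iff_of_embedding_eq V hc.1 (dW c.D 0) (dW_real c.D 0)).mp hpos.1
  · exact (cmXW_pos_iff_of_embedding_eq V hc.1 (dW c.D 1) (dW_real c.D 1)).mp hpos.2.1
  · exact (cmXW_pos_iff_of_embedding_eq V hc.1 (ArchSideTerm.dW' c.D 0) (ArchSideTerm.dW'_real c.D 0)).mp hpos.2.2.1
  · exact (cmXW_pos_iff_of_embedding_eq V hc.1 (ArchSideTerm.dW' c.D 1) (ArchSideTerm.dW'_real c.D 1)).mp hpos.2.2.2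

/-- the two routes agree (census `hpos_GOG` and recipe `SignsForced`); recorded as the `η_L`-spelling of the census anchor. [folklore] -/
theorem im_ι₁_eta_mul_a_pos_of_GOG (hc : GOG V c) (i : Fin 4) : 0 < (ι₁ (eta L * c.D.a i)).im :=
  im_ι₁_imagUnit_mul_a_pos_of_GOG V c hc i

/-- **Liu's admissibility sets at the OG guard** (bit-split): with the guard's `j` (`ι₁ ∘ j = c.σ`), for every `i`,
`{τ ∣ 0 < Im τ(δ_L a_i)}` is `Φ_{Ψ_i}^{(false)}` if `orientBitι L ι₁ = false` and `bar Φ_{Ψ_i}^{(true)}` if it is `true` — in either case the member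
of `{Φ, bar Φ}` that CONTAINS `ι₁`. [folklore] -/
theorem exists_posImSet_imagUnit_mul_of_GOG (hc : GOG V c) :
    ∃ j : c.K →+* L, ι₁.comp j = c.σ ∧ ∀ i : Fin 4,
      ι₁ ∈ {τ : L →+* ℂ | 0 < (τ (imagUnit (L : Type) * c.D.a i)).im} ∧
      ((Model.orientBitι L ι₁ = false →
          {τ : L →+* ℂ | 0 < (τ (imagUnit (L : Type) * c.D.a i)).im} = (liftType false c.K L j ι₁ (c.Ψ i)).1) ∧
       (Model.orientBitι L ι₁ = true →
          {τ : L →+* ℂ | 0 < (τ (imagUnit (L : Type) * c.D.a i)).im} = (bar (liftType true c.K L j ι₁ (c.Ψ i))).1)) := by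
  obtain ⟨j, hj, hs⟩ := hc.2.forced
  refine ⟨j, hj, fun i => ⟨im_ι₁_imagUnit_mul_a_pos_of_GOG V c hc i, fun hb => ?_, fun hb => ?_⟩⟩
  · have hs' : SignsForced false c.K L j ι₁ c.Ψ c.D := by rw [hb] at hs; exact hs
    exact posImSet_imagUnit_mul_eq_liftType_false hb hs' i
  · have hs' : SignsForced true c.K L j ι₁ c.Ψ c.D := by rw [hb] at hs; exact hs
    exact posImSet_imagUnit_mul_eq_bar_liftType_true hb hs' i

/-- **… and bit-free on a full orbit** (`L/ℚ` normal): `{τ ∣ 0 < Im τ(δ_L a_i)} = Φ_{Ψ_i}^{(false)}` (Shimura's `S*`-type of the corner, whose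
reflex pair is `(c.K, c.Ψ i)` by (R1)) and `{τ ∣ Im τ(δ_L a_i) < 0}` = its conjugate. [folklore] -/
theorem exists_posImSet_imagUnit_mul_of_GOG_of_orbit (hc : GOG V c) (horbit : ∀ τ : L →+* ℂ, ∃ g : L ≃+* L, ι₁.comp g.toRingHom = τ) :
    ∃ j : c.K →+* L, ι₁.comp j = c.σ ∧ ∀ i : Fin 4,
      {τ : L →+* ℂ | 0 < (τ (imagUnit (L : Type) * c.D.a i)).im} = (liftType false c.K L j ι₁ (c.Ψ i)).1 ∧
      {τ : L →+* ℂ | (τ (imagUnit (L : Type) * c.D.a i)).im < 0} = (bar (liftType false c.K L j ι₁ (c.Ψ i))).1 := by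
  obtain ⟨j, hj, hs⟩ := hc.2.forced
  exact ⟨j, hj, fun i => ⟨posImSet_imagUnit_mul_eq_liftType_false_of_orbit rfl hs horbit i,
    negImSet_imagUnit_mul_eq_bar_liftType_false_of_orbit rfl hs horbit i⟩⟩

end Model.SInstance

end HodgeCM

end
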